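import Mathlib.Algebra.Order.Field.Basic
import Mathlib.Algebra.Order.Field.Rat
import Mathlib.Algebra.Order.BigOperators.Group.Finset
import Mathlib.Algebra.BigOperators.Fin
import Mathlib.Data.Rat.Cast.Order
import Mathlib.Data.Rat.BigOperators
import Mathlib.Data.Real.Basic
import Mathlib.Data.Matrix.Basic
import Mathlib.LinearAlgebra.Matrix.Notation
import HarnessLib

/-!
# Rational LP-dual / Farkas certificates, checkable by `decide +kernel`

Compute-infrastructure file (unit `infra-psd-sos-lp-checker`). A finite system of linear
constraints with RATIONAL data
`A x ≤ b` (`m` rows) and `E x = f` (`p` rows) in `n` real (or ordered-field) unknowns, a linear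
objective `c` and a claimed bound `δ`. A *dual certificate* is a pair of rational multiplier
vectors `y ≥ 0` (for the inequality rows) and `z` (free, for the equality rows) with
`yᵀA + zᵀE = cᵀ` and `yᵀb + zᵀf ≤ δ`; weak LP duality then gives `c·x ≤ δ` for every feasible
`x`. With `c = 0`, `δ < 0` the same data is a Farkas certificate of infeasibility.

Everything the certificate asserts is a finite conjunction of (in)equalities between rational
numbers, so once the data are numerals the hypothesis `IsDualCert A b E f c δ y z` is closed by
`by decide +kernel` (the kernel evaluates the `Fin`-indexed sums in exact rational arithmetic;
`native_decide` is the user's option for very large systems, under the `--computational` regime).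
The soundness theorems are proved once here, over an arbitrary linearly ordered field `R` into
which the rational data are cast, so the conclusion is directly a statement about real vectors
`x : Fin n → ℝ`.

## API (namespace `Literature.Computation.Certificates.LP`)

* `LP.IsDualCert A b E f c δ y z` — the certificate predicate (decidable).
* `LP.IsDualCert.sound` — feasible `x` ⇒ `∑ j, c j * x j ≤ δ`; `sound_lt` for a strict bound.
* `LP.IsIneqCert A b c δ y` / `IsIneqCert.sound` — the same without equality rows.
* `LP.IsStdDualCert A c y` / `IsStdDualCert.sound` — textbook weak duality for
  `max {c·x : A x ≤ b, x ≥ 0}`: `y ≥ 0`, `Aᵀy ≥ c` ⇒ `c·x ≤ b·y`.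
* `LP.IsFarkasCert A b E f y z` / `IsFarkasCert.infeasible` — `y ≥ 0`, `yᵀA + zᵀE = 0`,
  `yᵀb + zᵀf < 0` ⇒ the system has no solution.
* Worked `example`s at the end (kernel-checked) double as tests and as usage templates.

Lower bounds `δ ≤ c·x`, `≥`-rows and bounds on single variables are obtained by negating rows /
objective (all data are rational, so this is exact); an equality `c·x = δ` is two certificates.

## References

Weak duality and Farkas' lemma are textbook material: G. Blekherman, P. Parrilo, R. Thomas
(eds.), *Semidefinite Optimization and Convex Algebraic Geometry*, SIAM 2012, §2.1.1, eq. (2.3)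
[cite: BlekhermanParriloThomas2012, §2.1.1 (2.3)]; A. Schrijver, *Theory of Linear and Integer
Programming*, Wiley 1986, §7.3–7.4. The certificate-checking statement shape follows
`Literature.Analysis.ValidatedNumerics.Verifier` (file `Analysis/ValidatedNumerics/Certificate`).

## Not here

No LP *solver* and no completeness (strong duality) statement: certificates are produced
off-line (exact rational LP, or a floating-point solver followed by rational rounding / repair)
and only *checked* in Lean.
-/

namespace Literature.Computation.Certificates

namespace LP

open Finset Matrix

variable {m p n : ℕ}
variable {R : Type*} [Field R] [LinearOrder R] [IsStrictOrderedRing R]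

/-! ### General form: `A x ≤ b`, `E x = f` -/

/-- **Dual (Farkas) certificate** for the bound `c·x ≤ δ` on the polyhedron
`{x | A x ≤ b, E x = f}`: multipliers `y ≥ 0` for the inequality rows and free multipliers `z`
for the equality rows with `yᵀA + zᵀE = cᵀ` and `yᵀb + zᵀf ≤ δ`. All data rational; decidable,
and meant to be discharged by `decide +kernel`.
[cite: BlekhermanParriloThomas2012, §2.1.1 (2.3)] -/
def IsDualCert (A : Matrix (Fin m) (Fin n) ℚ) (b : Fin m → ℚ) (E : Matrix (Fin p) (Fin n) ℚ)
    (f : Fin p → ℚ) (c : Fin n → ℚ) (δ : ℚ) (y : Fin m → ℚ) (z : Fin p → ℚ) : Prop :=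
  (∀ i, 0 ≤ y i) ∧ (∀ j, ∑ i, y i * A i j + ∑ i, z i * E i j = c j) ∧
    ∑ i, y i * b i + ∑ i, z i * f i ≤ δ

/-- The dual-certificate predicate is decidable (a finite conjunction of rational
(in)equalities). [folklore] -/
instance IsDualCert.instDecidable (A : Matrix (Fin m) (Fin n) ℚ) (b : Fin m → ℚ)
    (E : Matrix (Fin p) (Fin n) ℚ) (f : Fin p → ℚ) (c : Fin n → ℚ) (δ : ℚ) (y : Fin m → ℚ)
    (z : Fin p → ℚ) : Decidable (IsDualCert A b E f c δ y z) :=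
  inferInstanceAs (Decidable ((∀ i, 0 ≤ y i) ∧ (∀ j, ∑ i, y i * A i j + ∑ i, z i * E i j = c j) ∧
    ∑ i, y i * b i + ∑ i, z i * f i ≤ δ))

/-- The algebra behind weak duality: for ANY multipliers, `∑ⱼ (yᵀA + zᵀE)ⱼ xⱼ = ∑ᵢ yᵢ (A x)ᵢ +
∑ᵢ zᵢ (E x)ᵢ` (exchange of finite sums). [folklore] -/
theorem sum_combination_mul (A : Matrix (Fin m) (Fin n) ℚ) (E : Matrix (Fin p) (Fin n) ℚ)
    (y : Fin m → ℚ) (z : Fin p → ℚ) (x : Fin n → R) :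
    ∑ j, ((∑ i, y i * A i j + ∑ i, z i * E i j : ℚ) : R) * x j =
      ∑ i, (y i : R) * ∑ j, (A i j : R) * x j + ∑ i, (z i : R) * ∑ j, (E i j : R) * x j := by
  simp only [Rat.cast_add, Rat.cast_sum, Rat.cast_mul, add_mul, Finset.sum_add_distrib,
    Finset.sum_mul, Finset.mul_sum, mul_assoc]
  congr 1 <;> exact Finset.sum_comm

/-- **Weak duality / soundness of dual certificates.** If `(y, z)` is a dual certificate for
`c·x ≤ δ` and `x` (with coordinates in any linearly ordered field, e.g. `ℝ`) satisfies `A x ≤ b`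
and `E x = f`, then `∑ j, c j * x j ≤ δ`.
[cite: BlekhermanParriloThomas2012, §2.1.1 (2.3)] -/
theorem IsDualCert.sound {A : Matrix (Fin m) (Fin n) ℚ} {b : Fin m → ℚ}
    {E : Matrix (Fin p) (Fin n) ℚ} {f : Fin p → ℚ} {c : Fin n → ℚ} {δ : ℚ} {y : Fin m → ℚ}
    {z : Fin p → ℚ} (h : IsDualCert A b E f c δ y z) (x : Fin n → R)
    (hA : ∀ i, ∑ j, (A i j : R) * x j ≤ b i) (hE : ∀ i, ∑ j, (E i j : R) * x j = f i) :
    ∑ j, (c j : R) * x j ≤ δ := by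
  obtain ⟨hy, hc, hδ⟩ := h
  calc ∑ j, (c j : R) * x j
      = ∑ j, ((∑ i, y i * A i j + ∑ i, z i * E i j : ℚ) : R) * x j := by simp_rw [hc]
    _ = ∑ i, (y i : R) * ∑ j, (A i j : R) * x j + ∑ i, (z i : R) * ∑ j, (E i j : R) * x j :=
        sum_combination_mul A E y z x
    _ = ∑ i, (y i : R) * ∑ j, (A i j : R) * x j + ∑ i, (z i : R) * (f i : R) := by
        simp_rw [hE]
    _ ≤ ∑ i, (y i : R) * (b i : R) + ∑ i, (z i : R) * (f i : R) := by
        gcongr with i _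
        · exact_mod_cast hy i
        · exact hA i
    _ = ((∑ i, y i * b i + ∑ i, z i * f i : ℚ) : R) := by push_cast; rfl
    _ ≤ δ := by exact_mod_cast hδ

/-- Strict version: a dual certificate for `c·x ≤ δ'` with `δ' < δ` gives `c·x < δ`. [folklore] -/
theorem IsDualCert.sound_lt {A : Matrix (Fin m) (Fin n) ℚ} {b : Fin m → ℚ}
    {E : Matrix (Fin p) (Fin n) ℚ} {f : Fin p → ℚ} {c : Fin n → ℚ} {δ' : ℚ} {y : Fin m → ℚ}
    {z : Fin p → ℚ} (h : IsDualCert A b E f c δ' y z) {δ : ℚ} (hδ : δ' < δ) (x : Fin n → R)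
    (hA : ∀ i, ∑ j, (A i j : R) * x j ≤ b i) (hE : ∀ i, ∑ j, (E i j : R) * x j = f i) :
    ∑ j, (c j : R) * x j < δ :=
  (h.sound x hA hE).trans_lt (by exact_mod_cast hδ)

/-! ### Inequality form: `A x ≤ b` only -/

/-- Dual certificate for `c·x ≤ δ` on `{x | A x ≤ b}` (no equality rows): `y ≥ 0`, `yᵀA = cᵀ`,
`yᵀb ≤ δ`. [cite: BlekhermanParriloThomas2012, §2.1.1 (2.3)] -/
def IsIneqCert (A : Matrix (Fin m) (Fin n) ℚ) (b : Fin m → ℚ) (c : Fin n → ℚ) (δ : ℚ)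
    (y : Fin m → ℚ) : Prop :=
  (∀ i, 0 ≤ y i) ∧ (∀ j, ∑ i, y i * A i j = c j) ∧ ∑ i, y i * b i ≤ δ

/-- Decidability of `IsIneqCert`. [folklore] -/
instance IsIneqCert.instDecidable (A : Matrix (Fin m) (Fin n) ℚ) (b : Fin m → ℚ)
    (c : Fin n → ℚ) (δ : ℚ) (y : Fin m → ℚ) : Decidable (IsIneqCert A b c δ y) :=
  inferInstanceAs (Decidable ((∀ i, 0 ≤ y i) ∧ (∀ j, ∑ i, y i * A i j = c j) ∧
    ∑ i, y i * b i ≤ δ))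

/-- An inequality-form certificate is a general certificate with an empty equality block.
[folklore] -/
theorem IsIneqCert.isDualCert {A : Matrix (Fin m) (Fin n) ℚ} {b : Fin m → ℚ} {c : Fin n → ℚ}
    {δ : ℚ} {y : Fin m → ℚ} (h : IsIneqCert A b c δ y) :
    IsDualCert A b (Matrix.of ![] : Matrix (Fin 0) (Fin n) ℚ) ![] c δ y ![] := by
  obtain ⟨hy, hc, hδ⟩ := h
  exact ⟨hy, fun j => by simpa using hc j, by simpa using hδ⟩

/-- **Soundness, inequality form**: `A x ≤ b` and an `IsIneqCert` for `(c, δ)` give `c·x ≤ δ`.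
[cite: BlekhermanParriloThomas2012, §2.1.1 (2.3)] -/
theorem IsIneqCert.sound {A : Matrix (Fin m) (Fin n) ℚ} {b : Fin m → ℚ} {c : Fin n → ℚ}
    {δ : ℚ} {y : Fin m → ℚ} (h : IsIneqCert A b c δ y) (x : Fin n → R)
    (hA : ∀ i, ∑ j, (A i j : R) * x j ≤ b i) : ∑ j, (c j : R) * x j ≤ δ :=
  h.isDualCert.sound x hA (fun i => i.elim0)

/-- Strict version of `IsIneqCert.sound`. [folklore] -/
theorem IsIneqCert.sound_lt {A : Matrix (Fin m) (Fin n) ℚ} {b : Fin m → ℚ} {c : Fin n → ℚ}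
    {δ' : ℚ} {y : Fin m → ℚ} (h : IsIneqCert A b c δ' y) {δ : ℚ} (hδ : δ' < δ) (x : Fin n → R)
    (hA : ∀ i, ∑ j, (A i j : R) * x j ≤ b i) : ∑ j, (c j : R) * x j < δ :=
  (h.sound x hA).trans_lt (by exact_mod_cast hδ)

/-! ### Standard form: `max {c·x : A x ≤ b, x ≥ 0}` -/

/-- Textbook dual feasibility for the standard-form LP `max {c·x : A x ≤ b, x ≥ 0}`:
`y ≥ 0` and `Aᵀy ≥ c`. The bound it certifies is `b·y` (see `IsStdDualCert.sound`).
[cite: BlekhermanParriloThomas2012, §2.1.1 (2.3)] -/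
def IsStdDualCert (A : Matrix (Fin m) (Fin n) ℚ) (c : Fin n → ℚ) (y : Fin m → ℚ) : Prop :=
  (∀ i, 0 ≤ y i) ∧ ∀ j, c j ≤ ∑ i, y i * A i j

/-- Decidability of `IsStdDualCert`. [folklore] -/
instance IsStdDualCert.instDecidable (A : Matrix (Fin m) (Fin n) ℚ) (c : Fin n → ℚ)
    (y : Fin m → ℚ) : Decidable (IsStdDualCert A c y) :=
  inferInstanceAs (Decidable ((∀ i, 0 ≤ y i) ∧ ∀ j, c j ≤ ∑ i, y i * A i j))

/-- **Weak LP duality in standard form**: if `x ≥ 0`, `A x ≤ b`, `y ≥ 0` and `Aᵀy ≥ c`, then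
`c·x ≤ b·y`. [cite: BlekhermanParriloThomas2012, §2.1.1 (2.3)] -/
theorem IsStdDualCert.sound {A : Matrix (Fin m) (Fin n) ℚ} {c : Fin n → ℚ} {y : Fin m → ℚ}
    (h : IsStdDualCert A c y) (b : Fin m → ℚ) (x : Fin n → R) (hx : ∀ j, 0 ≤ x j)
    (hA : ∀ i, ∑ j, (A i j : R) * x j ≤ b i) :
    ∑ j, (c j : R) * x j ≤ ((∑ i, y i * b i : ℚ) : R) := by
  obtain ⟨hy, hc⟩ := h
  calc ∑ j, (c j : R) * x j
      ≤ ∑ j, ((∑ i, y i * A i j + ∑ i, (![] : Fin 0 → ℚ) i *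
          (Matrix.of ![] : Matrix (Fin 0) (Fin n) ℚ) i j : ℚ) : R) * x j := by
        gcongr with j _
        · exact hx j
        · simpa using hc j
    _ = ∑ i, (y i : R) * ∑ j, (A i j : R) * x j +
          ∑ i, ((![] : Fin 0 → ℚ) i : R) *
            ∑ j, ((Matrix.of ![] : Matrix (Fin 0) (Fin n) ℚ) i j : R) * x j :=
        sum_combination_mul A _ y _ x
    _ = ∑ i, (y i : R) * ∑ j, (A i j : R) * x j := by simp
    _ ≤ ∑ i, (y i : R) * (b i : R) := by
        gcongr with i _
        · exact_mod_cast hy i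
        · exact hA i
    _ = ((∑ i, y i * b i : ℚ) : R) := by push_cast; rfl

/-! ### Infeasibility (Farkas) -/

/-- **Farkas certificate of infeasibility** of `{x | A x ≤ b, E x = f}`: `y ≥ 0`,
`yᵀA + zᵀE = 0` and `yᵀb + zᵀf < 0`. [cite: BlekhermanParriloThomas2012, §2.1.1 (2.3)] -/
def IsFarkasCert (A : Matrix (Fin m) (Fin n) ℚ) (b : Fin m → ℚ) (E : Matrix (Fin p) (Fin n) ℚ)
    (f : Fin p → ℚ) (y : Fin m → ℚ) (z : Fin p → ℚ) : Prop :=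
  (∀ i, 0 ≤ y i) ∧ (∀ j, ∑ i, y i * A i j + ∑ i, z i * E i j = 0) ∧
    ∑ i, y i * b i + ∑ i, z i * f i < 0

/-- Decidability of `IsFarkasCert`. [folklore] -/
instance IsFarkasCert.instDecidable (A : Matrix (Fin m) (Fin n) ℚ) (b : Fin m → ℚ)
    (E : Matrix (Fin p) (Fin n) ℚ) (f : Fin p → ℚ) (y : Fin m → ℚ) (z : Fin p → ℚ) :
    Decidable (IsFarkasCert A b E f y z) :=
  inferInstanceAs (Decidable ((∀ i, 0 ≤ y i) ∧ (∀ j, ∑ i, y i * A i j + ∑ i, z i * E i j = 0) ∧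
    ∑ i, y i * b i + ∑ i, z i * f i < 0))

/-- **Soundness of Farkas certificates**: no point of any linearly ordered field satisfies a
system carrying a Farkas certificate. [cite: BlekhermanParriloThomas2012, §2.1.1 (2.3)] -/
theorem IsFarkasCert.infeasible {A : Matrix (Fin m) (Fin n) ℚ} {b : Fin m → ℚ}
    {E : Matrix (Fin p) (Fin n) ℚ} {f : Fin p → ℚ} {y : Fin m → ℚ} {z : Fin p → ℚ}
    (h : IsFarkasCert A b E f y z) (x : Fin n → R)
    (hA : ∀ i, ∑ j, (A i j : R) * x j ≤ b i) (hE : ∀ i, ∑ j, (E i j : R) * x j = f i) :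
    False := by
  obtain ⟨hy, hc, hδ⟩ := h
  have h' : IsDualCert A b E f 0 (∑ i, y i * b i + ∑ i, z i * f i) y z :=
    ⟨hy, fun j => by simpa using hc j, le_rfl⟩
  have := h'.sound_lt hδ x hA hE
  simp at this

/-! ### Tests / usage templates (kernel-checked) -/

/-- Test: on the triangle `x₀ + x₁ ≤ 4`, `-x₀ ≤ 0`, `-x₁ ≤ 0`, `x₀ - x₁ ≤ 1` the objective
`2x₀ + x₁` is at most `13/2` (attained at `(5/2, 3/2)`); certificate `y = (3/2, 0, 0, 1/2)`. -/
example (x : Fin 2 → ℝ)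
    (hA : ∀ i, ∑ j, ((!![1, 1; -1, 0; 0, -1; 1, -1] : Matrix (Fin 4) (Fin 2) ℚ) i j : ℝ) * x j ≤
      ((![4, 0, 0, 1] : Fin 4 → ℚ) i : ℝ)) :
    ∑ j, ((![2, 1] : Fin 2 → ℚ) j : ℝ) * x j ≤ ((13 / 2 : ℚ) : ℝ) :=
  by
  refine IsIneqCert.sound (y := ![3 / 2, 0, 0, 1 / 2]) ?_ x hA
  decide +kernel

/-- Test (general form with an equality row and a strict conclusion): `x₀ + x₁ + x₂ = 1`,
`x ≥ 0` (as rows `-xⱼ ≤ 0`) ⇒ `x₀ - x₂ < 2`; certificate `y = (0, 1, 2)`, `z = 1` proves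
`x₀ - x₂ ≤ 1`. -/
example (x : Fin 3 → ℚ)
    (hA : ∀ i, ∑ j, ((!![-1, 0, 0; 0, -1, 0; 0, 0, -1] : Matrix (Fin 3) (Fin 3) ℚ) i j : ℚ) * x j
      ≤ ((![0, 0, 0] : Fin 3 → ℚ) i : ℚ))
    (hE : ∀ i, ∑ j, ((!![1, 1, 1] : Matrix (Fin 1) (Fin 3) ℚ) i j : ℚ) * x j =
      ((![1] : Fin 1 → ℚ) i : ℚ)) :
    ∑ j, ((![1, 0, -1] : Fin 3 → ℚ) j : ℚ) * x j < ((2 : ℚ) : ℚ) :=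
  by
  refine IsDualCert.sound_lt (δ' := 1) (y := ![0, 1, 2]) (z := ![1]) ?_ (by norm_num) x hA hE
  decide +kernel

/-- Test (standard form weak duality): `A = [[1, 2], [3, 1]]`, `b = (4, 6)`, `c = (1, 1)`,
dual point `y = (2/5, 1/5)` with `Aᵀy = c`, value `b·y = 14/5`. -/
example (x : Fin 2 → ℝ) (hx : ∀ j, 0 ≤ x j)
    (hA : ∀ i, ∑ j, ((!![1, 2; 3, 1] : Matrix (Fin 2) (Fin 2) ℚ) i j : ℝ) * x j ≤
      ((![4, 6] : Fin 2 → ℚ) i : ℝ)) :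
    ∑ j, ((![1, 1] : Fin 2 → ℚ) j : ℝ) * x j ≤
      ((∑ i, (![2 / 5, 1 / 5] : Fin 2 → ℚ) i * (![4, 6] : Fin 2 → ℚ) i : ℚ) : ℝ) :=
  by
  refine IsStdDualCert.sound ?_ _ x hx hA
  decide +kernel

/-- Test (Farkas): `x₀ ≤ 0`, `-x₀ ≤ -1` is infeasible; certificate `y = (1, 1)`. -/
example (x : Fin 1 → ℝ)
    (hA : ∀ i, ∑ j, ((!![1; -1] : Matrix (Fin 2) (Fin 1) ℚ) i j : ℝ) * x j ≤
      ((![0, -1] : Fin 2 → ℚ) i : ℝ)) : False :=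
  by
  refine IsFarkasCert.infeasible (E := (Matrix.of ![] : Matrix (Fin 0) (Fin 1) ℚ)) (f := ![])
    (y := ![1, 1]) (z := ![]) ?_ x hA (fun i => i.elim0)
  decide +kernel

/-! ### Introduction lemmas (for block-wise `decide`, see `Certificates/Blocks.lean`) -/

/-- Assemble a dual certificate from its three conjuncts (each may be its own `decide +kernel`).
[folklore] -/
theorem IsDualCert.intro {A : Matrix (Fin m) (Fin n) ℚ} {b : Fin m → ℚ}
    {E : Matrix (Fin p) (Fin n) ℚ} {f : Fin p → ℚ} {c : Fin n → ℚ} {δ : ℚ} {y : Fin m → ℚ}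
    {z : Fin p → ℚ} (hy : ∀ i, 0 ≤ y i) (hc : ∀ j, ∑ i, y i * A i j + ∑ i, z i * E i j = c j)
    (hδ : ∑ i, y i * b i + ∑ i, z i * f i ≤ δ) : IsDualCert A b E f c δ y z :=
  ⟨hy, hc, hδ⟩

/-- Assemble an inequality-form certificate from its three conjuncts. [folklore] -/
theorem IsIneqCert.intro {A : Matrix (Fin m) (Fin n) ℚ} {b : Fin m → ℚ} {c : Fin n → ℚ} {δ : ℚ}
    {y : Fin m → ℚ} (hy : ∀ i, 0 ≤ y i) (hc : ∀ j, ∑ i, y i * A i j = c j)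
    (hδ : ∑ i, y i * b i ≤ δ) : IsIneqCert A b c δ y :=
  ⟨hy, hc, hδ⟩

/-- Assemble a standard-form dual certificate from its two conjuncts. [folklore] -/
theorem IsStdDualCert.intro {A : Matrix (Fin m) (Fin n) ℚ} {c : Fin n → ℚ} {y : Fin m → ℚ}
    (hy : ∀ i, 0 ≤ y i) (hc : ∀ j, c j ≤ ∑ i, y i * A i j) : IsStdDualCert A c y :=
  ⟨hy, hc⟩

/-- Assemble a Farkas certificate from its three conjuncts. [folklore] -/
theorem IsFarkasCert.intro {A : Matrix (Fin m) (Fin n) ℚ} {b : Fin m → ℚ}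
    {E : Matrix (Fin p) (Fin n) ℚ} {f : Fin p → ℚ} {y : Fin m → ℚ} {z : Fin p → ℚ}
    (hy : ∀ i, 0 ≤ y i) (hc : ∀ j, ∑ i, y i * A i j + ∑ i, z i * E i j = 0)
    (hδ : ∑ i, y i * b i + ∑ i, z i * f i < 0) : IsFarkasCert A b E f y z :=
  ⟨hy, hc, hδ⟩

end LP

end Literature.Computation.Certificates
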